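import Mathlib
import HarnessLib
import Literature.Analysis.FluidPDE.NSBoundedMildSmoothing
import Summits.NavierStokesRegularity.NavierStokesRegularity.Theorems.HalfSpaceWindowDoorCirculationCarryingRigidityDefs
import Summits.NavierStokesRegularity.NavierStokesRegularity.Theorems.HalfSpaceWindowDoorCirculationCarryingRigiditySubcriticalStretching
import Summits.NavierStokesRegularity.NavierStokesRegularity.Theorems.HalfSpaceWindowDoorCirculationCarryingRigidityCriticalStretching
import Summits.NavierStokesRegularity.NavierStokesRegularity.Theorems.PoloidalWindowDoorPoloidalWindowRigidityTypeIAnalytic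
import Summits.NavierStokesRegularity.NavierStokesRegularity.Theorems.PoloidalWindowDoorPoloidalWindowRigidityLocalStrongMaxPrinciple
import Summits.NavierStokesRegularity.NavierStokesRegularity.Theorems.ChiralWindowDoorClassDerivDecay

/-!
# Route `HalfSpaceWindowDoor`, crux `CirculationCarryingRigidity` (stmt-NavierStokesRegularity-25311) —
# critical `e₃`-stretching: FAR-PAST and LOCAL forms via real-analyticity of the class

`…CriticalStretching` excluded closed-hemisphere profiles whose `e₃`-stretching `σ = ⟪Dv[curl v], e₃⟫` obeys the
critical bound `(−s)σ ≤ ω₃` on the support of `ω₃` EVERYWHERE IN TIME.  The class is jointly real-analytic on the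
slab (tree `…PoloidalWindowDoorPoloidalWindowRigidityTypeIAnalytic.typeI_mild_analyticOnNhd`, Lemarié-Rieusset 2016
Thm 9.12), so local vanishing propagates; this file draws the two consequences for the census of 25311:

* `analyticOnNhd_inner_curl_e3` (+ `_time`, `_slice`) — `(t,y) ↦ ⟪curl v(t)(y), e₃⟫` is jointly real-analytic on
  `(−∞,0) × ℝ³` (partial derivative of the analytic `uncurry v` along `inr`, then the fixed linear maps `curlCLM`,
  `⟪·, e₃⟫`); `inner_curl_e3_eq_zero_of_far_past`, `inner_curl_e3_eq_const_of_ball` — identity theorems: `ω₃(·,y)`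
  vanishing before some `s₁ < 0` vanishes for all `s < 0`; a slice `ω₃(s,·)` constant on a ball is constant;
* `timeShift_class` — the class is invariant under PAST time shifts `v ↦ v(· + s₁)`, `s₁ ≤ 0`
  (`oseenDuhamel_translate`);
* `inner_curl_e3_eq_zero_of_eventually_critical` — **FAR-PAST CRITICAL STRETCHING SUFFICES**: if the critical bound
  holds at all points `(s, y)` with `s < s₁` and `ω₃(s,y) > 0` (some `s₁ < 0`), the profile is poloidal along `e₃`
  (shift by `s₁`: the shifted profile obeys the bound everywhere since `−s ≤ −(s + s₁)`; `…CriticalStretching`; then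
  analyticity in time).  Census: a surviving profile is strictly supercritically stretched at ARBITRARILY EARLY times
  (`exists_supercritical_before`);
* `not_extremal_of_locally_critical` — **LOCAL FORM AT THE EXTREMAL POINT**: an extremal profile (`(−s)ω₃ ≤ M`,
  `= M > 0` at `(−1,0)`) cannot obey the critical bound on any past cylinder `(−1−δ,−1] × B(0,ρ)` (LOCAL strong maximum
  principle `…LocalStrongMaxPrinciple.strongMaximumPrinciple_local` ⇒ `ω₃(−1−δ/2, ·)` constant on `B(0,ρ)` ⇒ constant on
  `ℝ³` by analyticity ⇒ excluded by `false_of_inner_curl_e3_eq_const`).  Census: strictly supercritical points with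
  `ω₃ > 0` ACCUMULATE AT THE EXTREMAL POINT from the past (`exists_supercritical_near_extremal_point`).

Seat ns-hsw-p1 g2 (LEAD of 25311, cell pub-ns-dss; helper `--supports` 25311).  WHAT THIS IS NOT: not a statement
about Navier–Stokes regularity — the door statements are regularity CRITERIA about HYPOTHETICAL blow-up profiles;
settled strata / structure of the open stub `NoExtremalHemisphereProfile`, not its closure.
-/

noncomputable section

-- the summit and its single sub-problem share the name (CONVENTIONS §1), as in every Theorems file
set_option linter.dupNamespace false

namespace Summit.NavierStokesRegularity.NavierStokesRegularity.Theorems.HalfSpaceWindowDoorCirculationCarryingRigidityCriticalStretchingAnalytic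

open MeasureTheory Set Function Filter Topology Metric
open scoped RealInnerProductSpace InnerProductSpace Laplacian ContDiff
open Literature.Analysis Literature.Analysis.FluidPDE Literature.Analysis.UnboundedOperators
open Summit.NavierStokesRegularity.NavierStokesRegularity.Theorems
open Summit.NavierStokesRegularity.NavierStokesRegularity.Theorems.HalfSpaceWindowDoorCirculationCarryingRigidityDefs
open Summit.NavierStokesRegularity.NavierStokesRegularity.Theorems.HalfSpaceWindowDoorCirculationCarryingRigiditySubcriticalStretching
  (hasDerivAt_inner_curl_e3)
open Summit.NavierStokesRegularity.NavierStokesRegularity.Theorems.HalfSpaceWindowDoorCirculationCarryingRigidityCriticalStretching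
  (false_of_inner_curl_e3_eq_const inner_stretch_nonpos_of_inner_curl_e3_eq_zero
    inner_curl_e3_eq_zero_of_critical_stretching_on_pos)
open Summit.NavierStokesRegularity.NavierStokesRegularity.Theorems.PoloidalWindowDoorPoloidalWindowRigidityTypeIAnalytic
  (typeI_mild_analyticOnNhd)
open Summit.NavierStokesRegularity.NavierStokesRegularity.Theorems.PoloidalWindowDoorPoloidalWindowRigidityLocalStrongMaxPrinciple
  (strongMaximumPrinciple_local)
open Summit.NavierStokesRegularity.NavierStokesRegularity.Theorems.ChiralWindowDoorClassDerivDecay (exists_classical_of_class)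

variable {C : ℝ} {v : ℝ → EuclideanSpace ℝ (Fin 3) → EuclideanSpace ℝ (Fin 3)}

/-! ### Real-analyticity of the `e₃`-vorticity -/

/-- **Joint real-analyticity of the `e₃`-vorticity.**  For a profile of the class (Type-I rate, continuity on the open
slab, Oseen–Duhamel identity), `(t, y) ↦ ⟪curl v(t)(y), e₃⟫` is real-analytic at every point of `(−∞,0) × ℝ³`:
`curl v(t)(y) = curlCLM (D(uncurry v)(t,y) ∘ inr)` is a fixed continuous linear map of the analytic derivative of the
analytic `uncurry v` (`typeI_mild_analyticOnNhd`). [cite: LemarieRieusset2016, Thm. 9.12] -/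
theorem analyticOnNhd_inner_curl_e3 (hrate : HasTypeITimeDecay C v)
    (hcont : ContinuousOn (uncurry v) (Iio (0 : ℝ) ×ˢ univ))
    (hmild : ∀ s t : ℝ, s < t → t < 0 → ∀ x, v t x = heatExtension (v s) (t - s) x - oseenDuhamel 1 s v v t x) :
    AnalyticOnNhd ℝ (fun p : ℝ × EuclideanSpace ℝ (Fin 3) => ⟪curl (v p.1) p.2, e3⟫)
      (Iio (0 : ℝ) ×ˢ (univ : Set (EuclideanSpace ℝ (Fin 3)))) := by
  set U : Set (ℝ × EuclideanSpace ℝ (Fin 3)) := Iio (0 : ℝ) ×ˢ univ with hU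
  have hUo : IsOpen U := isOpen_Iio.prod isOpen_univ
  have hG : AnalyticOnNhd ℝ (uncurry v) U := typeI_mild_analyticOnNhd C v hrate hcont hmild
  have hDG : AnalyticOnNhd ℝ (fderiv ℝ (uncurry v)) U := hG.fderiv
  -- the fixed linear map `L ↦ curlCLM (L ∘ inr)`
  set Ψ : (ℝ × EuclideanSpace ℝ (Fin 3) →L[ℝ] EuclideanSpace ℝ (Fin 3)) →L[ℝ] EuclideanSpace ℝ (Fin 3) :=
    curlCLM.comp ((ContinuousLinearMap.compL ℝ (EuclideanSpace ℝ (Fin 3)) (ℝ × EuclideanSpace ℝ (Fin 3))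
      (EuclideanSpace ℝ (Fin 3))).flip (ContinuousLinearMap.inr ℝ ℝ (EuclideanSpace ℝ (Fin 3)))) with hΨ
  have hH : AnalyticOnNhd ℝ (Ψ ∘ fderiv ℝ (uncurry v)) U := Ψ.comp_analyticOnNhd hDG
  have heq : U.EqOn (Ψ ∘ fderiv ℝ (uncurry v)) (fun p => curl (v p.1) p.2) := by
    intro p hp
    have hd : HasFDerivAt (uncurry v) (fderiv ℝ (uncurry v) p) (p.1, p.2) := by
      rw [Prod.mk.eta]; exact (hG p hp).differentiableAt.hasFDerivAt
    have h1 : HasFDerivAt (uncurry v ∘ fun z : EuclideanSpace ℝ (Fin 3) => (p.1, z))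
        ((fderiv ℝ (uncurry v) p).comp (ContinuousLinearMap.inr ℝ ℝ (EuclideanSpace ℝ (Fin 3)))) p.2 :=
      hd.comp p.2 (hasFDerivAt_prodMk_right p.1 p.2)
    have h2 : fderiv ℝ (v p.1) p.2 =
        (fderiv ℝ (uncurry v) p).comp (ContinuousLinearMap.inr ℝ ℝ (EuclideanSpace ℝ (Fin 3))) := by
      have hfun : (uncurry v ∘ fun z : EuclideanSpace ℝ (Fin 3) => (p.1, z)) = v p.1 := by funext z; rfl
      rw [← hfun]; exact h1.fderiv
    simp only [comp_apply, hΨ, ContinuousLinearMap.comp_apply, ContinuousLinearMap.flip_apply,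
      ContinuousLinearMap.compL_apply, curl_eq_curlCLM, h2]
  have hcurl : AnalyticOnNhd ℝ (fun p : ℝ × EuclideanSpace ℝ (Fin 3) => curl (v p.1) p.2) U := hH.congr hUo heq
  have hinner := (innerSL ℝ e3).comp_analyticOnNhd hcurl
  refine hinner.congr hUo fun p _ => ?_
  simp only [comp_apply, innerSL_apply_apply, real_inner_comm]

/-- The time line `τ ↦ ⟪curl v(τ)(y), e₃⟫` is real-analytic on `(−∞, 0)` for every `y`. [cite: LemarieRieusset2016, Thm. 9.12] -/
theorem analyticOnNhd_inner_curl_e3_time (hrate : HasTypeITimeDecay C v)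
    (hcont : ContinuousOn (uncurry v) (Iio (0 : ℝ) ×ˢ univ))
    (hmild : ∀ s t : ℝ, s < t → t < 0 → ∀ x, v t x = heatExtension (v s) (t - s) x - oseenDuhamel 1 s v v t x)
    (y : EuclideanSpace ℝ (Fin 3)) :
    AnalyticOnNhd ℝ (fun τ : ℝ => ⟪curl (v τ) y, e3⟫) (Iio (0 : ℝ)) :=
  (analyticOnNhd_inner_curl_e3 hrate hcont hmild).comp₂ analyticOnNhd_id analyticOnNhd_const
    fun _ hτ => mk_mem_prod hτ (mem_univ _)

/-- The slice `y ↦ ⟪curl v(s)(y), e₃⟫` is real-analytic on `ℝ³` for every `s < 0`. [cite: LemarieRieusset2016, Thm. 9.12] -/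
theorem analyticOnNhd_inner_curl_e3_slice (hrate : HasTypeITimeDecay C v)
    (hcont : ContinuousOn (uncurry v) (Iio (0 : ℝ) ×ˢ univ))
    (hmild : ∀ s t : ℝ, s < t → t < 0 → ∀ x, v t x = heatExtension (v s) (t - s) x - oseenDuhamel 1 s v v t x)
    {s : ℝ} (hs : s < 0) :
    AnalyticOnNhd ℝ (fun y : EuclideanSpace ℝ (Fin 3) => ⟪curl (v s) y, e3⟫) univ :=
  (analyticOnNhd_inner_curl_e3 hrate hcont hmild).comp₂ analyticOnNhd_const analyticOnNhd_id
    fun _ _ => mk_mem_prod hs (mem_univ _)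

/-- **Identity theorem in time**: if `ω₃(τ, y) = 0` for all `τ < s₁` (some `s₁ < 0`) and all `y`, then `ω₃ ≡ 0` on the
whole slab. [cite: LemarieRieusset2016, Thm. 9.12] -/
theorem inner_curl_e3_eq_zero_of_far_past (hrate : HasTypeITimeDecay C v)
    (hcont : ContinuousOn (uncurry v) (Iio (0 : ℝ) ×ˢ univ))
    (hmild : ∀ s t : ℝ, s < t → t < 0 → ∀ x, v t x = heatExtension (v s) (t - s) x - oseenDuhamel 1 s v v t x)
    {s₁ : ℝ} (hs₁ : s₁ < 0) (h : ∀ τ < s₁, ∀ y, ⟪curl (v τ) y, e3⟫ = 0) :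
    ∀ τ < 0, ∀ y, ⟪curl (v τ) y, e3⟫ = 0 := by
  intro τ hτ y
  have han := analyticOnNhd_inner_curl_e3_time hrate hcont hmild y
  have hev : (fun σ : ℝ => ⟪curl (v σ) y, e3⟫) =ᶠ[𝓝 (s₁ - 1)] 0 := by
    filter_upwards [Iio_mem_nhds (show s₁ - 1 < s₁ by linarith)] with σ hσ
    exact h σ hσ y
  have h0 : s₁ - 1 ∈ Iio (0 : ℝ) := by
    change s₁ - 1 < 0
    linarith
  exact han.eqOn_zero_of_preconnected_of_eventuallyEq_zero isPreconnected_Iio h0 hev hτ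

/-- **Identity theorem in space**: a slice `ω₃(s, ·)` (`s < 0`) that is constant on an open ball is constant on `ℝ³`.
[cite: LemarieRieusset2016, Thm. 9.12] -/
theorem inner_curl_e3_eq_const_of_ball (hrate : HasTypeITimeDecay C v)
    (hcont : ContinuousOn (uncurry v) (Iio (0 : ℝ) ×ˢ univ))
    (hmild : ∀ s t : ℝ, s < t → t < 0 → ∀ x, v t x = heatExtension (v s) (t - s) x - oseenDuhamel 1 s v v t x)
    {s : ℝ} (hs : s < 0) {m ρ : ℝ} (hρ : 0 < ρ) {x₀ : EuclideanSpace ℝ (Fin 3)}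
    (h : ∀ y, ‖y - x₀‖ < ρ → ⟪curl (v s) y, e3⟫ = m) : ∀ y, ⟪curl (v s) y, e3⟫ = m := by
  intro y
  have han := analyticOnNhd_inner_curl_e3_slice hrate hcont hmild hs
  have hev : (fun z : EuclideanSpace ℝ (Fin 3) => ⟪curl (v s) z, e3⟫) =ᶠ[𝓝 x₀] fun _ => m := by
    filter_upwards [Metric.ball_mem_nhds x₀ hρ] with z hz
    exact h z (by rwa [mem_ball, dist_eq_norm] at hz)
  exact han.eqOn_of_preconnected_of_eventuallyEq analyticOnNhd_const isPreconnected_univ (mem_univ x₀) hev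
    (mem_univ y)

/-! ### Past time shifts of the class -/

/-- **The class is invariant under past time shifts.**  For `s₁ ≤ 0`, the shifted profile `v(· + s₁)` has the Type-I
rate with the same constant (`√(−t) ≤ √(−t − s₁)`), is continuous on the open slab, and satisfies the
Oseen–Duhamel identity (`oseenDuhamel_translate`) and the divergence constraint. [folklore] -/
theorem timeShift_class (hrate : HasTypeITimeDecay C v)
    (hcont : ContinuousOn (uncurry v) (Iio (0 : ℝ) ×ˢ univ))
    (hmild : ∀ s t : ℝ, s < t → t < 0 → ∀ x, v t x = heatExtension (v s) (t - s) x - oseenDuhamel 1 s v v t x)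
    (hdiv : ∀ t < 0, VectorCalculus.IsDivFree (v t)) {s₁ : ℝ} (hs₁ : s₁ ≤ 0) :
    HasTypeITimeDecay C (fun τ => v (τ + s₁)) ∧
      ContinuousOn (uncurry fun τ => v (τ + s₁)) (Iio (0 : ℝ) ×ˢ univ) ∧
      (∀ s t : ℝ, s < t → t < 0 → ∀ x, (fun τ => v (τ + s₁)) t x =
        heatExtension ((fun τ => v (τ + s₁)) s) (t - s) x -
          oseenDuhamel 1 s (fun τ => v (τ + s₁)) (fun τ => v (τ + s₁)) t x) ∧
      (∀ t < 0, VectorCalculus.IsDivFree ((fun τ => v (τ + s₁)) t)) := by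
  have hC0 : 0 ≤ C := by
    have h := hrate (-1) (by norm_num) 0
    rw [neg_neg, Real.sqrt_one, div_one] at h
    exact (norm_nonneg _).trans h
  refine ⟨fun t ht x => ?_, ?_, fun s t hst ht x => ?_, fun t ht => hdiv (t + s₁) (by linarith)⟩
  · have hts : t + s₁ < 0 := by linarith
    refine (hrate (t + s₁) hts x).trans ?_
    exact div_le_div_of_nonneg_left hC0 (Real.sqrt_pos.2 (neg_pos.2 ht))
      (Real.sqrt_le_sqrt (by linarith))
  · have hφ : Continuous fun p : ℝ × EuclideanSpace ℝ (Fin 3) => (p.1 + s₁, p.2) := by fun_prop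
    have hmaps : MapsTo (fun p : ℝ × EuclideanSpace ℝ (Fin 3) => (p.1 + s₁, p.2)) (Iio (0 : ℝ) ×ˢ univ)
        (Iio (0 : ℝ) ×ˢ univ) := by
      intro p hp
      have h1 : p.1 < 0 := (mem_prod.1 hp).1
      exact mk_mem_prod (show p.1 + s₁ < 0 by linarith) (mem_univ _)
    have hcomp := hcont.comp hφ.continuousOn hmaps
    refine hcomp.congr fun p _ => ?_
    simp only [uncurry, comp_apply]
  · have h := hmild (s + s₁) (t + s₁) (by linarith) (by linarith) x
    show v (t + s₁) x = heatExtension (v (s + s₁)) (t - s) x -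
      oseenDuhamel 1 s (fun τ => v (τ + s₁)) (fun τ => v (τ + s₁)) t x
    rw [oseenDuhamel_translate 1 s s₁ v v t x]
    simpa only [add_sub_add_right_eq_sub] using h

/-! ### Far-past critical stretching suffices -/

/-- **FAR-PAST CRITICAL STRETCHING EXCLUSION.**  A closed-hemisphere profile of the class for which, for some `s₁ < 0`,
the critical bound `(−s)·⟪Dv(s,y)[curl v(s,y)], e₃⟫ ≤ ⟪curl v(s,y), e₃⟫` holds at every point with `s < s₁` and
`⟪curl v(s,y), e₃⟫ > 0`, is poloidal along `e₃` on the WHOLE slab.  (The past shift `v(· + s₁)` is a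
closed-hemisphere class profile obeying the bound everywhere on the support — `−s ≤ −(s + s₁)` when the stretching is
nonnegative, trivially otherwise — hence poloidal by `inner_curl_e3_eq_zero_of_critical_stretching_on_pos`; so
`ω₃ ≡ 0` before `s₁`, and then everywhere by analyticity in time.)
[cite: Lieberman1996, Ch. II Thm. 2.7; LemarieRieusset2016, Thm. 9.12] -/
theorem inner_curl_e3_eq_zero_of_eventually_critical :
    ∀ (C : ℝ) (v : ℝ → EuclideanSpace ℝ (Fin 3) → EuclideanSpace ℝ (Fin 3)),
    Literature.Analysis.FluidPDE.HasTypeITimeDecay C v →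
    ContinuousOn (Function.uncurry v) (Set.Iio (0 : ℝ) ×ˢ Set.univ) →
    (∀ s t : ℝ, s < t → t < 0 → ∀ x, v t x =
      Literature.Analysis.UnboundedOperators.heatExtension (v s) (t - s) x -
        Literature.Analysis.FluidPDE.oseenDuhamel 1 s v v t x) →
    (∀ t < 0, Literature.Analysis.FluidPDE.VectorCalculus.IsDivFree (v t)) →
    (∀ s < 0, ∀ y, 0 ≤ ⟪Literature.Analysis.FluidPDE.curl (v s) y, e3⟫_ℝ) →
    ∀ s₁ < 0,
    (∀ s < s₁, ∀ y, 0 < ⟪Literature.Analysis.FluidPDE.curl (v s) y, e3⟫_ℝ →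
      (-s) * ⟪fderiv ℝ (v s) y (Literature.Analysis.FluidPDE.curl (v s) y), e3⟫_ℝ ≤
        ⟪Literature.Analysis.FluidPDE.curl (v s) y, e3⟫_ℝ) →
    ∀ s < 0, ∀ y, ⟪Literature.Analysis.FluidPDE.curl (v s) y, e3⟫_ℝ = 0 := by
  intro C v hrate hcont hmild hdiv hnn s₁ hs₁ hcrit
  obtain ⟨hrate', hcont', hmild', hdiv'⟩ := timeShift_class hrate hcont hmild hdiv hs₁.le
  have hnn' : ∀ s < 0, ∀ y, 0 ≤ ⟪curl ((fun τ => v (τ + s₁)) s) y, e3⟫ :=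
    fun s hs y => hnn (s + s₁) (by linarith) y
  have hcrit' : ∀ s < 0, ∀ y, 0 < ⟪curl ((fun τ => v (τ + s₁)) s) y, e3⟫ →
      (-s) * ⟪fderiv ℝ ((fun τ => v (τ + s₁)) s) y (curl ((fun τ => v (τ + s₁)) s) y), e3⟫ ≤
        ⟪curl ((fun τ => v (τ + s₁)) s) y, e3⟫ := by
    intro s hs y hpos
    have h := hcrit (s + s₁) (by linarith) y hpos
    rcases le_or_gt 0 ⟪fderiv ℝ (v (s + s₁)) y (curl (v (s + s₁)) y), e3⟫ with hσ | hσ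
    · have hmono : (-s) * ⟪fderiv ℝ (v (s + s₁)) y (curl (v (s + s₁)) y), e3⟫ ≤
          (-(s + s₁)) * ⟪fderiv ℝ (v (s + s₁)) y (curl (v (s + s₁)) y), e3⟫ :=
        mul_le_mul_of_nonneg_right (by linarith) hσ
      exact hmono.trans h
    · have : (-s) * ⟪fderiv ℝ (v (s + s₁)) y (curl (v (s + s₁)) y), e3⟫ < 0 :=
        mul_neg_of_pos_of_neg (neg_pos.2 hs) hσ
      exact (this.trans hpos).le
  have hzero := inner_curl_e3_eq_zero_of_critical_stretching_on_pos hrate' hcont' hmild' hdiv' hnn' hcrit'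
  have hpast : ∀ τ < s₁, ∀ y, ⟪curl (v τ) y, e3⟫ = 0 := by
    intro τ hτ y
    have h := hzero (τ - s₁) (by linarith) y
    simpa only [sub_add_cancel] using h
  exact inner_curl_e3_eq_zero_of_far_past hrate hcont hmild hs₁ hpast

/-- **Census form: survivors are strictly supercritically stretched at arbitrarily early times.**  If a closed-hemisphere
profile of the class has `⟪curl v(s₀,y₀), e₃⟫ > 0` somewhere, then for every `s₁ < 0` there is a point `(s, y)` with
`s < s₁`, `⟪curl v(s,y), e₃⟫ > 0` and `⟪curl v(s,y), e₃⟫ < (−s)·⟪Dv(s,y)[curl v(s,y)], e₃⟫`.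
[cite: Lieberman1996, Ch. II Thm. 2.7; LemarieRieusset2016, Thm. 9.12] -/
theorem exists_supercritical_before (hrate : HasTypeITimeDecay C v)
    (hcont : ContinuousOn (uncurry v) (Iio (0 : ℝ) ×ˢ univ))
    (hmild : ∀ s t : ℝ, s < t → t < 0 → ∀ x, v t x = heatExtension (v s) (t - s) x - oseenDuhamel 1 s v v t x)
    (hdiv : ∀ t < 0, VectorCalculus.IsDivFree (v t)) (hnn : ∀ s < 0, ∀ y, 0 ≤ ⟪curl (v s) y, e3⟫)
    {s₀ : ℝ} (hs₀ : s₀ < 0) {y₀ : EuclideanSpace ℝ (Fin 3)} (hpos : 0 < ⟪curl (v s₀) y₀, e3⟫)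
    {s₁ : ℝ} (hs₁ : s₁ < 0) :
    ∃ s : ℝ, s < s₁ ∧ ∃ y, 0 < ⟪curl (v s) y, e3⟫ ∧
      ⟪curl (v s) y, e3⟫ < (-s) * ⟪fderiv ℝ (v s) y (curl (v s) y), e3⟫ := by
  by_contra hcon
  push Not at hcon
  have h := inner_curl_e3_eq_zero_of_eventually_critical C v hrate hcont hmild hdiv hnn s₁ hs₁
    (fun s hs y hp => hcon s hs y hp) s₀ hs₀ y₀
  linarith

/-! ### The local form at the extremal point -/

variable {M : ℝ} {W : ℝ → EuclideanSpace ℝ (Fin 3) → EuclideanSpace ℝ (Fin 3)}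

/-- **No extremal profile is critically stretched near its extremal point.**  Let `W` be a closed-hemisphere profile
of the class with `(−s)·⟪curl W(s)(y), e₃⟫ ≤ M` everywhere and `⟪curl W(−1)(0), e₃⟫ = M > 0`.  Then for NO `δ, ρ > 0`
does the critical bound `(−s)σ ≤ ω₃` hold at all points of the past cylinder `(−1−δ, −1] × B(0, ρ)` where `ω₃ > 0`:
otherwise `w = (−s)ω₃` is a sub-solution in the open cylinder (at zeros of `ω₃` the stretching is `≤ 0`,
`inner_stretch_nonpos_of_inner_curl_e3_eq_zero`) attaining its maximum at the top centre, so `w ≡ M` on the cylinder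
(`strongMaximumPrinciple_local`), the slice `ω₃(−1−δ/2, ·)` is the constant `M/(1+δ/2)` on `B(0,ρ)`, hence on `ℝ³`
(analyticity), contradicting `false_of_inner_curl_e3_eq_const`.
[cite: Lieberman1996, Ch. II Thm. 2.7; LemarieRieusset2016, Thm. 9.12] -/
theorem not_extremal_of_locally_critical (hrate : HasTypeITimeDecay C W)
    (hcont : ContinuousOn (uncurry W) (Iio (0 : ℝ) ×ˢ univ))
    (hmild : ∀ s t : ℝ, s < t → t < 0 → ∀ x, W t x = heatExtension (W s) (t - s) x - oseenDuhamel 1 s W W t x)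
    (hdiv : ∀ t < 0, VectorCalculus.IsDivFree (W t)) (hnn : ∀ s < 0, ∀ y, 0 ≤ ⟪curl (W s) y, e3⟫)
    (hM : 0 < M) (hmax : ∀ s < 0, ∀ y, (-s) * ⟪curl (W s) y, e3⟫ ≤ M) (hval : ⟪curl (W (-1)) 0, e3⟫ = M)
    {δ ρ : ℝ} (hδ : 0 < δ) (hρ : 0 < ρ)
    (hcrit : ∀ s ∈ Ioc (-1 - δ) (-1 : ℝ), ∀ y : EuclideanSpace ℝ (Fin 3), ‖y‖ < ρ → 0 < ⟪curl (W s) y, e3⟫ →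
      (-s) * ⟪fderiv ℝ (W s) y (curl (W s) y), e3⟫ ≤ ⟪curl (W s) y, e3⟫) : False := by
  -- the class is classical, hence a vorticity solution on `(−∞,0)`
  obtain ⟨q, hcl⟩ := exists_classical_of_class hrate hcont hmild hdiv
  have hS : IsOpen (Iio (0 : ℝ)) := isOpen_Iio
  have hV : IsVorticitySolutionOn (Iio (0 : ℝ)) 1 W :=
    hcl.isVorticitySolutionOn_zero_force hS.uniqueDiffOn (by rw [interior_Iio]; exact subset_closure)
  have hω : IsSmoothSpaceTimeOn (Iio (0 : ℝ)) (vorticity W) :=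
    hV.smooth_velocity.isSmoothSpaceTimeOn_vorticity hS.uniqueDiffOn
  have hω3s : IsSmoothSpaceTimeOn (Iio (0 : ℝ)) fun t y => ⟪curl (W t) y, e3⟫ :=
    hω.inner (isSmoothSpaceTimeOn_const_time contDiff_const _)
  have hneg : IsSmoothSpaceTimeOn (Iio (0 : ℝ)) fun (t : ℝ) (_ : EuclideanSpace ℝ (Fin 3)) => -t :=
    fun p _ => (contDiff_fst (𝕜 := ℝ) (E := ℝ) (F := EuclideanSpace ℝ (Fin 3))).neg.contDiffAt.contDiffWithinAt
  -- the weighted component `w = (−t) ω₃` and its time derivative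
  set w : ℝ → EuclideanSpace ℝ (Fin 3) → ℝ := fun t y => (-t) * ⟪curl (W t) y, e3⟫ with hw
  set wt : ℝ → EuclideanSpace ℝ (Fin 3) → ℝ := fun t y =>
    -1 * ⟪curl (W t) y, e3⟫ +
      (-t) * ((Δ fun z => ⟪curl (W t) z, e3⟫) y - fderiv ℝ (fun z => ⟪curl (W t) z, e3⟫) y (W t y)
        + ⟪fderiv ℝ (W t) y (curl (W t) y), e3⟫) with hwt
  have hws : IsSmoothSpaceTimeOn (Iio (0 : ℝ)) w := hneg.mul hω3s
  have hIcc : ∀ t ∈ Icc (-1 - δ) (-1 : ℝ), t < 0 := fun t ht => lt_of_le_of_lt ht.2 (by norm_num)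
  have hslab : Icc (-1 - δ) (-1 : ℝ) ×ˢ (univ : Set (EuclideanSpace ℝ (Fin 3))) ⊆ Iio 0 ×ˢ univ :=
    prod_mono (fun t ht => hIcc t ht) le_rfl
  have hw_c : ContinuousOn (uncurry w) (Icc (-1 - δ) (-1 : ℝ) ×ˢ univ) := hws.continuousOn.mono hslab
  have hw2 : ∀ t ∈ Icc (-1 - δ) (-1 : ℝ), ContDiff ℝ 2 (w t) := fun t ht =>
    (hws.contDiff_slice (hIcc t ht)).of_le (by norm_cast)
  have hwt' : ∀ y, ∀ t ∈ Icc (-1 - δ) (-1 : ℝ), HasDerivAt (fun s => w s y) (wt t y) t := by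
    intro y t ht
    have h := (hasDerivAt_neg' (x := t)).fun_mul (hasDerivAt_inner_curl_e3 hV (hIcc t ht) y)
    simpa only [hw, hwt] using h
  -- the critical bound holds at every point of the open cylinder (automatic at zeros of `ω₃`)
  have hcrit' : ∀ t ∈ Ioc (-1 - δ) (-1 : ℝ), ∀ y : EuclideanSpace ℝ (Fin 3), ‖y‖ < ρ →
      (-t) * ⟪fderiv ℝ (W t) y (curl (W t) y), e3⟫ ≤ ⟪curl (W t) y, e3⟫ := by
    intro t ht y hy
    have ht0 : t < 0 := lt_of_le_of_lt ht.2 (by norm_num)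
    rcases (hnn t ht0 y).lt_or_eq with hpos | hzero
    · exact hcrit t ht y hy hpos
    · have h := inner_stretch_nonpos_of_inner_curl_e3_eq_zero hrate hcont hmild hdiv hnn ht0 hzero.symm
      rw [← hzero]
      nlinarith [neg_pos.2 ht0]
  -- the sub-solution inequality in the open cylinder
  have hlaw : ∀ t ∈ Ioc (-1 - δ) (-1 : ℝ), ∀ y : EuclideanSpace ℝ (Fin 3), ‖y - 0‖ < ρ →
      wt t y + fderiv ℝ (w t) y (W t y) - (Δ (w t)) y ≤ 0 := by
    intro t ht y hy
    rw [sub_zero] at hy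
    have ht0 : t < 0 := lt_of_le_of_lt ht.2 (by norm_num)
    have hωt2 : ContDiff ℝ 2 fun z => ⟪curl (W t) z, e3⟫ := (hω3s.contDiff_slice ht0).of_le (by norm_cast)
    have hfun : w t = (-t) • fun z => ⟪curl (W t) z, e3⟫ := by
      funext z; simp only [hw, Pi.smul_apply, smul_eq_mul]
    have hΔ : (Δ (w t)) y = (-t) * (Δ fun z => ⟪curl (W t) z, e3⟫) y := by
      rw [hfun, InnerProductSpace.laplacian_smul _ hωt2.contDiffAt, smul_eq_mul]
    have hD : fderiv ℝ (w t) y (W t y) = (-t) * fderiv ℝ (fun z => ⟪curl (W t) z, e3⟫) y (W t y) := by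
      rw [hfun, fderiv_const_smul (hωt2.differentiable two_ne_zero y)]
      simp only [FunLike.coe_smul, Pi.smul_apply, smul_eq_mul]
    rw [hΔ, hD]
    simp only [hwt]
    nlinarith [hcrit' t ht y hy]
  -- drift bound and `w ≤ M` on the closed cylinder; maximum at the top centre
  have hC0 : 0 ≤ C := by
    have h := hrate (-1) (by norm_num) 0
    rw [neg_neg, Real.sqrt_one, div_one] at h
    exact (norm_nonneg _).trans h
  have hbA : ∀ t ∈ Icc (-1 - δ) (-1 : ℝ), ∀ x : EuclideanSpace ℝ (Fin 3), ‖x - 0‖ ≤ ρ → ‖W t x‖ ≤ C := by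
    intro t ht x _
    refine (hrate t (hIcc t ht) x).trans (div_le_self hC0 ?_)
    exact Real.one_le_sqrt.2 (by linarith [ht.2])
  have hle : ∀ t ∈ Icc (-1 - δ) (-1 : ℝ), ∀ x : EuclideanSpace ℝ (Fin 3), ‖x - 0‖ ≤ ρ → w t x ≤ M :=
    fun t ht x _ => hmax t (hIcc t ht) x
  have hts : (-1 : ℝ) ∈ Ioc (-1 - δ) (-1 : ℝ) := ⟨by linarith, le_rfl⟩
  have hxs : ‖(0 : EuclideanSpace ℝ (Fin 3)) - 0‖ < ρ := by simpa using hρ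
  have hmaxpt : w (-1) 0 = M := by simp only [hw, hval]; ring
  have hSMP := strongMaximumPrinciple_local hbA hw_c hw2 hwt' hlaw hle hts hxs hmaxpt
  -- the slice `s⋆ = −1 − δ/2` is constant on the ball, hence everywhere
  set sst : ℝ := -1 - δ / 2 with hsst
  have hsI : sst ∈ Ico (-1 - δ) (-1 : ℝ) := ⟨by rw [hsst]; linarith, by rw [hsst]; linarith⟩
  have hs0 : sst < 0 := by rw [hsst]; linarith
  have hms : 0 < -sst := neg_pos.2 hs0
  have hball : ∀ y : EuclideanSpace ℝ (Fin 3), ‖y - 0‖ < ρ → ⟪curl (W sst) y, e3⟫ = M / (-sst) := by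
    intro y hy
    have h := hSMP sst hsI y hy
    simp only [hw] at h
    exact (eq_div_iff hms.ne').2 (by rw [mul_comm]; exact h)
  have hconst := inner_curl_e3_eq_const_of_ball hrate hcont hmild hs0 hρ hball
  exact false_of_inner_curl_e3_eq_const hrate hcont hmild hdiv hnn hs0 (div_pos hM hms) hconst

/-- **Census form: strictly supercritical points accumulate at the extremal point from the past.**  For an extremal
closed-hemisphere profile as above and every `δ, ρ > 0` there is a point `(s, y)` with `−1−δ < s ≤ −1`, `‖y‖ < ρ`,
`⟪curl W(s)(y), e₃⟫ > 0` and `⟪curl W(s)(y), e₃⟫ < (−s)·⟪DW(s,y)[curl W(s,y)], e₃⟫`.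
[cite: Lieberman1996, Ch. II Thm. 2.7; LemarieRieusset2016, Thm. 9.12] -/
theorem exists_supercritical_near_extremal_point (hrate : HasTypeITimeDecay C W)
    (hcont : ContinuousOn (uncurry W) (Iio (0 : ℝ) ×ˢ univ))
    (hmild : ∀ s t : ℝ, s < t → t < 0 → ∀ x, W t x = heatExtension (W s) (t - s) x - oseenDuhamel 1 s W W t x)
    (hdiv : ∀ t < 0, VectorCalculus.IsDivFree (W t)) (hnn : ∀ s < 0, ∀ y, 0 ≤ ⟪curl (W s) y, e3⟫)
    (hM : 0 < M) (hmax : ∀ s < 0, ∀ y, (-s) * ⟪curl (W s) y, e3⟫ ≤ M) (hval : ⟪curl (W (-1)) 0, e3⟫ = M)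
    {δ ρ : ℝ} (hδ : 0 < δ) (hρ : 0 < ρ) :
    ∃ s ∈ Ioc (-1 - δ) (-1 : ℝ), ∃ y : EuclideanSpace ℝ (Fin 3), ‖y‖ < ρ ∧ 0 < ⟪curl (W s) y, e3⟫ ∧
      ⟪curl (W s) y, e3⟫ < (-s) * ⟪fderiv ℝ (W s) y (curl (W s) y), e3⟫ := by
  by_contra hcon
  push Not at hcon
  exact not_extremal_of_locally_critical hrate hcont hmild hdiv hnn hM hmax hval hδ hρ
    fun s hs y hy hp => hcon s hs y hy hp

end Summit.NavierStokesRegularity.NavierStokesRegularity.Theorems.HalfSpaceWindowDoorCirculationCarryingRigidityCriticalStretchingAnalytic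

end
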